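import Summits.QuantumFields.BalabanUV.T4Continuum.Support.NE7CriticalOrbitUniqueGeneric
import HarnessLib

/-!
# NE7CriticalOrbitAnyDatum — «FOR ε₀ SUFFICIENTLY SMALL THERE IS AT MOST ONE CRITICAL ORBIT» FOR EVERY DATUM ([Balaban1985Variational] p. 278: «Our problem is to find all
# critical orbits of the functional (5). We will prove that for ε₀ sufficiently small there is at most one critical orbit. To prove the existence we have to assume that V
# satisfies some additional regularity property»): for every `U(n)`, every `L ≥ 2`, `d = 4`, every `0 < ε ≤ ε₀(n, L)`, every torus `N ≥ 1`, EVERY datum `V` (no smallness,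
# no regularity) and every level: a critical point of the constrained problem in `admissible (sfClass 4 L N ε) L k V` is a GLOBAL MINIMISER there, and any two critical points
# are periodic unitary gauge copies of each other — gen 113's H1 (`NE7CriticalOrbitUniqueGeneric`, stated over the small data through the minimiser `U♯`) with the datum
# hypothesis REMOVED: the role-swapped coercivity argument never used it

Cell `pub-balaban`, rung (B)+1 sub-cell t4, lineage `b2b-balaban-t4-ne7-p1` (CRUX PROVER NE7 #1 = OWNER of BINDER row NE7), generation 113.  Memo
`t4/b2b-balaban-t4-ne7-p1-g113/ROAD-G113.md` §1bis.  Same chain as H1: gen 109's `vary_eq_self_of_tanCritical_rep_generic` (centre: admissible + tangent-critical; competitor: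
admissible, no larger action), the symmetric pair decomposition `decomp_of_nl0_pair_generic` (any datum `D`), the class package's (hT)∕(hP) (any `N ≥ 1`), the k-free line.
THE ARGUMENT.  Two admissible configurations over the same datum are comparable in action (total order of ℝ).  If `U₁` is critical and `A(U₂) ≤ A(U₁)`, the coercivity lemma
centred at `U₁` with competitor `U₂` gives `U₂^{u} = U₁e^{X}`, `X = 0`: `U₂ ∈ orbit(U₁)`, so `A(U₂) = A(U₁)`.  Hence (a) a critical `U₁` has `A(U₁) ≤ A(U₂)` for EVERY admissible
`U₂` (else `U₂` would lie in the orbit with a smaller action) — critical ⇒ global minimiser; (b) two critical points: order them by action and apply the same.  Level `0`: the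
admissible set is contained in `{V}`.
WHAT ([folklore]; 0 def, 0 sorry; `d = 4`, every `U(n)`, every `L ≥ 2`).  **`critical_is_minimiser_any_datum`**: `∃ ε₀ > 0, ∀ 0 < ε ≤ ε₀, ∀ N ≥ 1, ∀ V k, ∀ U₁ ∈ admissible
(sfClass 4 L N ε) L k V, (k = j+1 → U₁ tangent-critical at level j+1) → IsMinimiser 4 (sfClass 4 L N ε) L N k V U₁ ∧ ∀ U₂ ∈ admissible …, (k = j+1 → U₂ tangent-critical) →
∃ u, IsUnitarySite u ∧ IsPeriodicSite u (N·L^k) ∧ gaugeAct u U₂ = U₁`.  CRITICALITY as in H1: stationarity of the Wilson action of the period along every periodic `𝔲(n)`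
direction in `TangentIter L j U` (the tangent space of the constraint manifold).
DICTIONARY WITH PRINT: «at most one critical orbit [in the space (6)] for ε₀ sufficiently small» — no hypothesis on `V` ✓ (existence is the separate clause (7)–(8), ✓ p810221
over the small data); ours adds: every critical orbit is the MINIMAL one.
HONEST FRAMING (page 1): composition of landed kernel theorems of this lineage (gens 90–113) and rows NE3∕NE3-R2 AS TYPED; nothing of Bałaban's asserted as an axiom and NOT
his method (Sect. E's contraction); finite 4-torus; threshold `ε₀(n, L)` existential; NOT NE7 as a spine node (dagwriter∕referees' call), NOT NE3; spine 0∕9; NOT infinite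
volume, NOT mass gap, NOT BetaPertH, NOT Clay (continuum YM on T⁴ ⇐ BetaPertH ∧ nine spine estimates).
-/

set_option autoImplicit false

open scoped BigOperators Matrix Matrix.Norms.L2Operator
open NormedSpace Finset Set

namespace Summit.QuantumFields.BalabanUV.T4Continuum.NE7CriticalOrbitAnyDatum

open Literature.MathematicalPhysics.QuantumFieldTheory.Balaban1983to89
open B7Prop1Explicit B7Prop2Explicit
open T4AveragingDeficitWall (IsUnitaryCfg IsSkewDir SmallField vary curl curlSq dirSq)
open T4AveragingDeficitWallBoundary (IsPeriodicCfg periodBox)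
open AveragingDeficitPeriodicCounting (IsPeriodicDir)
open AveragingDeficitMultiLevelPrep (LevelSmall TangentIter)
open MinimalActionLevels (perWin levelAction)
open MinimalActionSandwich (IsMinimiser admissible)
open MinimalActionRate (sfClass)
open NE3HessForm (dAction)
open NE3SlicePoincareShape (SlicePoincare slicePoincare_mono)
open NE3EnergyShapes (IsUnitarySite IsPeriodicSite gaugeAct_one)
open NE3EnergyWeightedShapes (energyNormW)
open NE7MeanZeroGaugeSliceW (energyBlockLandauW)
open NE7ConvOneStepGenericSlice (hT_energyBlockLandau)
open NE7ConvOneStepGenericSliceTangent (vary_eq_self_of_tanCritical_rep_generic)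
open NE7PairDecompNL0Generic (decomp_of_nl0_pair_generic)
open NE7EnergyRateWGeneric (line_of_small_card kfree_coercivity_card)
open NE7EnergyClassPoincareGeneric (classPackage)
open NE7EtaMinimiserGaugeCovariance (levelAction_gaugeAct isUnitarySite_inv isPeriodicSite_inv)
open BlockAverageCurrent (smallField_gaugeAct)
open NE7AllMinimisersSmallGeneric (eq_of_admissible_zero)
open AveragingDeficitKDatum (gaugeAct_inv_gaugeAct)

noncomputable section

variable {n : Type} [Fintype n] [DecidableEq n]

/-- **AT MOST ONE CRITICAL ORBIT FOR EVERY DATUM, AND IT IS THE MINIMAL ONE — EVERY `U(n)`, EVERY `L ≥ 2`, `d = 4`** (statement and argument in the file header): for `0 < ε ≤ ε₀(n, L)`,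
`N ≥ 1`, ANY datum `V` and any level, a critical point of the constrained problem in `admissible (sfClass 4 L N ε) L k V` is a global minimiser there, and every other critical
point is a periodic unitary gauge copy of it. [folklore] -/
theorem critical_is_minimiser_any_datum [Nonempty n] {L : ℕ} (hL : 2 ≤ L) :
    ∃ ε₀ : ℝ, 0 < ε₀ ∧ ∀ ε : ℝ, 0 < ε → ε ≤ ε₀ → ∀ (N : ℕ) [NeZero N], 1 ≤ N →
      ∀ (V : Site 4 → Fin 4 → (Matrix n n ℂ)ˣ) (k : ℕ), ∀ U₁ ∈ admissible (sfClass 4 L N ε) L k V,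
        (∀ j : ℕ, k = j + 1 → ∀ φ : Site 4 → Fin 4 → Matrix n n ℂ, IsSkewDir φ → IsPeriodicDir φ ((N * L ^ (j + 1) : ℕ) : ℤ) →
            TangentIter L j U₁ φ → dAction U₁ φ (perWin 4 (N * L ^ (j + 1))) = 0) →
        IsMinimiser 4 (sfClass 4 L N ε) L N k V U₁ ∧
          ∀ U₂ ∈ admissible (sfClass 4 L N ε) L k V,
            (∀ j : ℕ, k = j + 1 → ∀ φ : Site 4 → Fin 4 → Matrix n n ℂ, IsSkewDir φ → IsPeriodicDir φ ((N * L ^ (j + 1) : ℕ) : ℤ) →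
                TangentIter L j U₂ φ → dAction U₂ φ (perWin 4 (N * L ^ (j + 1))) = 0) →
            ∃ u : Site 4 → (Matrix n n ℂ)ˣ, IsUnitarySite u ∧ IsPeriodicSite u ((N * L ^ k : ℕ) : ℤ) ∧ gaugeAct u U₂ = U₁ := by
  haveI : NeZero L := ⟨by omega⟩
  have hL1 : 1 ≤ L := by omega
  have hL0 : (0 : ℝ) < L := by exact_mod_cast (show 0 < L by omega)
  obtain ⟨ε₂, hε₂, CS, hCS, νc, hνc, κc, hκc, hdec⟩ := decomp_of_nl0_pair_generic (n := n) hL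
  obtain ⟨θ₀, CF, CE, hθ₀, -, -, hCE, -, -, hlsP, -, hPE⟩ := classPackage (n := n) (d := 4) (by norm_num) hL
  -- the k-free line with the Poincaré constant `C_E + 1` (verbatim from gen 109)
  obtain ⟨CP, hCP⟩ : ∃ CP : ℝ, CP = CE + 1 := ⟨_, rfl⟩
  have hCP1 : 1 ≤ CP := by rw [hCP]; linarith
  have hCP0 : 0 < CP := by linarith
  obtain ⟨Q, hQ⟩ : ∃ Q : ℝ, Q = 2 * (1 + CP) := ⟨_, rfl⟩
  have hQ4 : 4 ≤ Q := by rw [hQ]; linarith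
  have hQ0 : 0 < Q := by linarith
  obtain ⟨cL, hcL⟩ : ∃ cL : ℝ, cL = 2 * κc + νc ^ 2 + 2304 * (CS ^ 2 * Real.exp (2 * CS)) + 112 * (1 + 7 * CS ^ 2) + 1 := ⟨_, rfl⟩
  have hcL0 : 0 < cL := by rw [hcL]; positivity
  have hcard1 : (1 : ℝ) ≤ (Fintype.card n : ℝ) := by exact_mod_cast Fintype.card_pos
  have hcard0 : (0 : ℝ) < (Fintype.card n : ℝ) := by linarith
  obtain ⟨ε₃, hε₃⟩ : ∃ ε₃ : ℝ, ε₃ = (1 / 2) / Q / 4 / (Fintype.card n : ℝ) / cL := ⟨_, rfl⟩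
  have hε₃0 : 0 < ε₃ := by rw [hε₃]; positivity
  have hcard : (0 : ℝ) < 1000000000000000000000 * (L : ℝ) ^ 6 * (Fintype.card n : ℝ) := by positivity
  refine ⟨min ε₂ (min θ₀ (min (1 / (1000000000000000000000 * (L : ℝ) ^ 6 * (Fintype.card n : ℝ))) (min ε₃ 1))),
    lt_min hε₂ (lt_min hθ₀ (lt_min (by positivity) (lt_min hε₃0 one_pos))), ?_⟩
  intro ε hε hεle N _ hN V k
  have hεε₂ : ε ≤ ε₂ := hεle.trans (min_le_left _ _)
  have hεθ₀ : ε ≤ θ₀ := hεle.trans ((min_le_right _ _).trans (min_le_left _ _))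
  have hεθ : ε ≤ 1 / (1000000000000000000000 * (L : ℝ) ^ 6 * (Fintype.card n : ℝ)) :=
    hεle.trans ((min_le_right _ _).trans ((min_le_right _ _).trans (min_le_left _ _)))
  have hεε₃ : ε ≤ ε₃ := hεle.trans ((min_le_right _ _).trans ((min_le_right _ _).trans ((min_le_right _ _).trans (min_le_left _ _))))
  have hε1 : ε ≤ 1 := hεle.trans ((min_le_right _ _).trans ((min_le_right _ _).trans ((min_le_right _ _).trans (min_le_right _ _))))
  have hθline : 1000000000000000000000 * (L : ℝ) ^ 6 * (Fintype.card n : ℝ) * ε ≤ 1 := by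
    rw [le_div_iff₀ hcard] at hεθ; linarith
  have hsmall : cL * ε ≤ (1 / 2) / Q / 4 / (Fintype.card n : ℝ) := by
    have h1 : cL * ε ≤ cL * ε₃ := mul_le_mul_of_nonneg_left hεε₃ hcL0.le
    have h2 : cL * ε₃ = (1 / 2) / Q / 4 / (Fintype.card n : ℝ) := by rw [hε₃]; field_simp
    linarith only [h1, h2]
  have hline := line_of_small_card (c := (Fintype.card n : ℝ)) hQ4 hcard1 hCS hε hε1 (by rw [← hcL]; exact hsmall)
  have hls : ∀ j : ℕ, LevelSmall 4 L j (ε / ((L : ℝ) ^ (j + 1)) ^ 2) := hlsP hε.le hεθ₀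
  have hT : ∀ (j : ℕ) (W : Site 4 → Fin 4 → (Matrix n n ℂ)ˣ), W ∈ sfClass 4 L N ε (j + 1) → ∀ F : Finset (T4AveragingDeficitWall.Plaq 4),
      (∀ φ : Site 4 → Fin 4 → Matrix n n ℂ, IsSkewDir φ → IsPeriodicDir φ ((AveragingDeficitMultiLevelPrep.tower L N (j + 1) : ℕ) : ℤ) →
        TangentIter L j W φ → dAction W φ F = 0) →
      ∀ Y ∈ energyBlockLandauW (d := 4) (n := n) L N (j + 1) W, dAction W Y F = 0 :=
    fun j W hW F htan => hT_energyBlockLandau hL1 hε.le hls j W hW F htan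
  have hP : ∀ (j : ℕ) (W : Site 4 → Fin 4 → (Matrix n n ℂ)ˣ), W ∈ sfClass 4 L N ε (j + 1) →
      SlicePoincare L (j + 1) W (energyBlockLandauW (d := 4) (n := n) L N (j + 1) W) CP (periodBox (d := 4) (N * L ^ (j + 1))) :=
    fun j W hW => slicePoincare_mono (hPE hN hε hεθ₀ j W hW) (by rw [hCP]; linarith)
  cases k with
  | zero =>
      -- level 0: the admissible set is contained in `{V}`
      intro U₁ hU₁ _
      refine ⟨⟨hU₁, fun U₂ hU₂ => by rw [eq_of_admissible_zero hU₁, eq_of_admissible_zero hU₂]⟩, fun U₂ hU₂ _ => ?_⟩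
      refine ⟨fun _ => 1, fun _ => (unitaryUnits (Matrix n n ℂ)).one_mem, fun _ _ => rfl, ?_⟩
      rw [gaugeAct_one, eq_of_admissible_zero hU₂, eq_of_admissible_zero hU₁]
  | succ j =>
      have hM1 : (1 : ℝ) ≤ (L : ℝ) ^ (j + 1) := one_le_pow₀ (by exact_mod_cast hL1)
      -- THE RIGIDITY AT A CRITICAL CENTRE: an admissible competitor with no larger action is in the orbit of the centre
      have hrigid : ∀ U₁ ∈ admissible (sfClass 4 L N ε) L (j + 1) V,
          (∀ φ : Site 4 → Fin 4 → Matrix n n ℂ, IsSkewDir φ → IsPeriodicDir φ ((N * L ^ (j + 1) : ℕ) : ℤ) →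
            TangentIter L j U₁ φ → dAction U₁ φ (perWin 4 (N * L ^ (j + 1))) = 0) →
          ∀ U₂ ∈ admissible (sfClass 4 L N ε) L (j + 1) V, levelAction 4 L N (j + 1) U₂ ≤ levelAction 4 L N (j + 1) U₁ →
            ∃ u : Site 4 → (Matrix n n ℂ)ˣ, IsUnitarySite u ∧ IsPeriodicSite u ((N * L ^ (j + 1) : ℕ) : ℤ) ∧ gaugeAct u U₂ = U₁ := by
        intro U₁ hU₁ hcrit₁ U₂ hU₂ hle₂
        obtain ⟨u, X, XT, XN, α, ν, κ, hu, huP, hXs, hXP, hα, hXα, hgauge, hXdec, hXT, -, hXN, hν, hNw, hN1, hαM, hνle, hκle⟩ :=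
          hdec N ε hε hεε₂ hθline V j U₁ hU₁ U₂ hU₂
        have hck := kfree_coercivity_card (c := (Fintype.card n : ℝ)) (ε := ε) hcard0 hCP0.le hM1 hν hνle hα hαM
        have hlinek : 2 * κ < ((((1 / 2 - ν ^ 2) / (2 * (1 + CP)) - ν ^ 2) / 2
            - 576 * ((4 : ℕ) : ℝ) * (Real.exp α - 1) ^ 2 * ((L : ℝ) ^ (j + 1)) ^ 2) / (Fintype.card n : ℝ)
            - 28 * ((4 : ℕ) : ℝ) * (ε / ((L : ℝ) ^ (j + 1)) ^ 2 + 7 * α ^ 2) * ((L : ℝ) ^ (j + 1)) ^ 2) := by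
          rw [hQ] at hline
          have h2κ : 2 * κ ≤ 2 * (κc * ε) := by linarith
          push_cast at hck hline ⊢
          linarith
        have hle : levelAction 4 L N (j + 1) (vary U₁ X 1) ≤ levelAction 4 L N (j + 1) U₂ := by
          rw [← hgauge, levelAction_gaugeAct]
        have h1 : SmallField (vary U₁ X 1) (ε / ((L : ℝ) ^ (j + 1)) ^ 2) := by
          rw [← hgauge]; exact smallField_gaugeAct hu hU₂.1.2.2
        obtain ⟨-, hself⟩ := vary_eq_self_of_tanCritical_rep_generic (d := 4) hL1 hN hε.le hCP0
          (fun j W => energyBlockLandauW (d := 4) (n := n) L N (j + 1) W) hT hP hU₁ hcrit₁ hle₂ hXs hXP hα hXα hle h1 hXdec hXT hXN hNw hN1 hlinek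
        refine ⟨u, hu, huP, ?_⟩
        rw [hgauge, hself]
      intro U₁ hU₁ hcritU₁
      have hcrit₁ := hcritU₁ j rfl
      -- (a) critical ⇒ global minimiser
      have hmin₁ : IsMinimiser 4 (sfClass 4 L N ε) L N (j + 1) V U₁ := by
        refine ⟨hU₁, fun U₂ hU₂ => ?_⟩
        rcases le_or_gt (levelAction 4 L N (j + 1) U₁) (levelAction 4 L N (j + 1) U₂) with h | h
        · exact h
        · obtain ⟨u, -, -, hg⟩ := hrigid U₁ hU₁ hcrit₁ U₂ hU₂ h.le
          rw [← hg, levelAction_gaugeAct]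
      -- (b) two critical points are in one orbit
      refine ⟨hmin₁, fun U₂ hU₂ hcritU₂ => hrigid U₁ hU₁ hcrit₁ U₂ hU₂ (?_)⟩
      have hcrit₂ := hcritU₂ j rfl
      rcases le_or_gt (levelAction 4 L N (j + 1) U₂) (levelAction 4 L N (j + 1) U₁) with h | h
      · exact h
      · -- `A(U₁) < A(U₂)` with `U₂` critical: `U₁` is in the orbit of `U₂`, so the actions agree
        obtain ⟨u, -, -, hg⟩ := hrigid U₂ hU₂ hcrit₂ U₁ hU₁ h.le
        rw [← hg, levelAction_gaugeAct]

end

end Summit.QuantumFields.BalabanUV.T4Continuum.NE7CriticalOrbitAnyDatum
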